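import Summits.ResolutionOfSingularities.ResolutionOfSingularities.Theses.PAlteration
import Summits.ResolutionOfSingularities.ResolutionOfSingularities.Theorems.PAlterationAssembly2FunctionField
import Literature.AlgebraicGeometry.Resolution.ProperModelsJoin
import Literature.AlgebraicGeometry.Resolution.ProperModelsFunctionField
import Literature.AlgebraicGeometry.Resolution.NormalizationInExtensionGenericPoint
import Mathlib.FieldTheory.PurelyInseparable.PerfectClosure
import Mathlib.FieldTheory.IsAlgClosed.AlgebraicClosure
import HarnessLib

/-!
# Crux `Pialt` (stmt-ResolutionOfSingularities-0555), line `SketchIdeator2` (PiTMP programme):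
# EXACTNESS — `Pialt` implies purely inseparable two-model patching

Stub `piTwoModelPatching_of_pialt` of the lead's skeleton (line lead c5, 2026-08-17). "Purely inseparable
two-model patching in characteristic `p`" (PiTMP, the body of `stub_piTwoModelPatching`): given finite
purely inseparable extensions `L₁, L₂` of a field `K ⊇ k` and proper models `M₁` of `L₁/k`, `M₂` of
`L₂/k`, there are ONE finite purely inseparable `L ⊇ K` containing `L₁, L₂` over `K` and a proper model `N`
of `L/k` dominating `M₁` and `M₂` compatibly with the generic points, regular above the regular loci.
Here: the crux `Pialt` (every integral separated scheme of finite type over a field of characteristic `p`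
has a purely inseparable REGULAR alteration) implies PiTMP, with an `N` that is regular everywhere:

* `exists_common_purelyInseparable_extension₂` — two finite purely inseparable extensions of `K` embed
  over `K` into one (compositum inside an algebraic closure; it lies in the relative perfect closure).
* `ProperModel.exists_normalizationIn_model` — for a proper model `M` of `K'/k` and a finite extension
  `L₀ ⊇ K'`, the normalisation `M^{L₀}` of `M` in `L₀` (`normalizationIn`, finite over `M` by E. Noether)
  with the `L₀`-point `Spec L₀ → M^{L₀}` (a preimmersion onto the generic point: `K(M^{L₀}) = L₀`) is a
  proper model of `L₀/k` dominating `M` compatibly with `Spec L₀ → Spec K' → M`.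
* `piTwoModelPatching_of_pialt` — take a common `L₀ ⊇ L₁, L₂`, the proper models `M₁^{L₀}`, `M₂^{L₀}` of
  `L₀` and their join `J` (`ProperModel.join`); `Pialt` at the integral proper `k`-scheme `J` gives
  `g : Y → J` proper surjective with `Y` integral regular, finite and universally injective over a dense
  open, so `L := K(Y)` is finite purely inseparable over `K(J) = L₀`
  (`finiteDimensional_functionFieldOver_of_finite`, `isPurelyInseparable_functionFieldOver_of_universallyInjective`),
  hence over `K`; and `Y` with its generic point `Spec K(Y) → Y` is the sought proper model `N` of `L/k`.

References: O. Zariski, P. Samuel, *Commutative Algebra* II, Ch. VI §17 (models, joins); Q. Liu, *Algebraic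
Geometry and Arithmetic Curves* (2002), Def. 4.1.24, Prop. 4.1.27 (normalisation in a finite extension);
M. Temkin, J. Algebra 373 (2013), Conj. 1.3.1 (`Pialt`).
-/

set_option linter.dupNamespace false -- mandated namespace of this single-conjunct summit

noncomputable section

open CategoryTheory AlgebraicGeometry
open Literature.AlgebraicGeometry.Resolution

namespace Summit.ResolutionOfSingularities.ResolutionOfSingularities.Theorems.Pialt.RadiciallyRegular

/-! ## A common finite purely inseparable extension of two -/

/-- **Two finite purely inseparable extensions `L₁, L₂` of a field `K` embed over `K` into one finite
purely inseparable extension `L` of `K`**: the compositum of their images in an algebraic closure of `K`,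
finite-dimensional and contained in the relative perfect closure (Mathlib `le_perfectClosure_iff`).
[folklore] -/
theorem exists_common_purelyInseparable_extension₂ (K L₁ L₂ : Type) [Field K] [Field L₁] [Field L₂]
    [Algebra K L₁] [Algebra K L₂] [FiniteDimensional K L₁] [FiniteDimensional K L₂]
    [IsPurelyInseparable K L₁] [IsPurelyInseparable K L₂] :
    ∃ (L : Type) (_ : Field L) (_ : Algebra K L), FiniteDimensional K L ∧ IsPurelyInseparable K L ∧
      Nonempty (L₁ →ₐ[K] L) ∧ Nonempty (L₂ →ₐ[K] L) := by
  let E := AlgebraicClosure K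
  let φ₁ : L₁ →ₐ[K] E := IsAlgClosed.lift
  let φ₂ : L₂ →ₐ[K] E := IsAlgClosed.lift
  let L : IntermediateField K E := φ₁.fieldRange ⊔ φ₂.fieldRange
  haveI h₁ : FiniteDimensional K φ₁.fieldRange :=
    LinearEquiv.finiteDimensional φ₁.equivFieldRange.toLinearEquiv
  haveI h₂ : FiniteDimensional K φ₂.fieldRange :=
    LinearEquiv.finiteDimensional φ₂.equivFieldRange.toLinearEquiv
  haveI : FiniteDimensional K L := IntermediateField.finiteDimensional_sup _ _
  have hp₁ : IsPurelyInseparable K φ₁.fieldRange := AlgEquiv.isPurelyInseparable φ₁.equivFieldRange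
  have hp₂ : IsPurelyInseparable K φ₂.fieldRange := AlgEquiv.isPurelyInseparable φ₂.equivFieldRange
  have hL : L ≤ perfectClosure K E :=
    sup_le ((le_perfectClosure_iff (L := φ₁.fieldRange)).mpr hp₁)
      ((le_perfectClosure_iff (L := φ₂.fieldRange)).mpr hp₂)
  haveI : IsPurelyInseparable K L := (le_perfectClosure_iff (L := L)).mp hL
  exact ⟨L, inferInstance, inferInstance, inferInstance, inferInstance,
    ⟨(IntermediateField.inclusion (le_sup_left : φ₁.fieldRange ≤ L)).comp φ₁.equivFieldRange.toAlgHom⟩,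
    ⟨(IntermediateField.inclusion (le_sup_right : φ₂.fieldRange ≤ L)).comp φ₂.equivFieldRange.toAlgHom⟩⟩

/-! ## The normalisation of a proper model in a finite extension is a proper model of the extension -/

/-- A morphism of commutative rings out of a field which is surjective is an isomorphism (it is
injective, the target being non-trivial). [folklore] -/
theorem isIso_of_isField_of_surjective {R S : CommRingCat.{0}} (f : R ⟶ S) [Nontrivial S]
    (hR : IsField R) (hs : Function.Surjective f.hom) : IsIso f := by
  letI := hR.toField
  exact (ConcreteCategory.isIso_iff_bijective f).mpr ⟨f.hom.injective, hs⟩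

/-- **The normalisation of a proper model `M` of `K'/k` in a finite extension `L₀ ⊇ K'` is a proper model
of `L₀/k` dominating `M`.** With `K(M) ≅ K'` (`ProperModel.funFieldIso`) making `L₀` a finite extension of
`K(M)`, the normalisation `M^{L₀} → M` (`normalizationIn`, `normalizationInι`) is finite (E. Noether,
`isFinite_normalizationInι`), so `M^{L₀}` is an integral proper `k`-scheme; its `L₀`-point
`Spec L₀ → M^{L₀}` (Mathlib `toNormalization`) hits the generic point (`toNormalization_apply`) and is a
preimmersion (`isPreimmersion_toNormalization`: `K(M^{L₀}) = L₀`), so `𝒪_{M^{L₀},ξ} → L₀` is bijective;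
and `Spec L₀ → M^{L₀} → M` is `Spec L₀ → Spec K' → M` (`gen_M`). [cite: Liu2002, Def. 4.1.24 and Prop. 4.1.27] -/
theorem _root_.Literature.AlgebraicGeometry.Resolution.ProperModel.exists_normalizationIn_model
    {k K' : Type} [Field k] [Field K'] [Algebra k K'] (M : ProperModel k K') (L₀ : Type) [Field L₀]
    [Algebra K' L₀] [Algebra k L₀] [IsScalarTower k K' L₀] [FiniteDimensional K' L₀] :
    ∃ (P : ProperModel k L₀) (ν : P.X ⟶ M.X), ν ≫ M.π = P.π ∧
      P.gen ≫ ν = Spec.map (CommRingCat.ofHom (algebraMap K' L₀)) ≫ M.gen := by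
  -- `L₀` as a finite extension of `K(M) ≅ K'`
  letI algFL : Algebra M.X.functionField L₀ :=
    ((algebraMap K' L₀).comp M.funFieldIso.hom.hom).toAlgebra
  letI algKF : Algebra K' M.X.functionField := M.funFieldIso.inv.hom.toAlgebra
  haveI : IsScalarTower K' M.X.functionField L₀ :=
    IsScalarTower.of_algebraMap_eq fun x => by
      change algebraMap K' L₀ x = algebraMap K' L₀ (M.funFieldIso.hom.hom (M.funFieldIso.inv.hom x))
      rw [← CommRingCat.comp_apply, Iso.inv_hom_id, CommRingCat.id_apply]
  haveI : Module.Finite M.X.functionField L₀ :=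
    Module.Finite.of_restrictScalars_finite K' M.X.functionField L₀
  -- the normalisation and its two structure maps
  haveI : IsFinite (normalizationInι M.X L₀) := isFinite_normalizationInι M.X L₀ M.π
  have hτν : (fromSpecExtension M.X L₀).toNormalization ≫ normalizationInι M.X L₀ =
      fromSpecExtension M.X L₀ :=
    (fromSpecExtension M.X L₀).toNormalization_fromNormalization
  have hext : fromSpecExtension M.X L₀ = Spec.map (CommRingCat.ofHom (algebraMap K' L₀)) ≫ M.gen := by
    change Spec.map (CommRingCat.ofHom ((algebraMap K' L₀).comp M.funFieldIso.hom.hom)) ≫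
      M.X.fromSpecStalk (genericPoint M.X) = _
    rw [CommRingCat.ofHom_comp, CommRingCat.ofHom_hom, Spec.map_comp, Category.assoc,
      ProperModel.specMap_funFieldIso_hom_fromSpecStalk]
  have hgenπ : (fromSpecExtension M.X L₀).toNormalization ≫ normalizationInι M.X L₀ ≫ M.π =
      Spec.map (CommRingCat.ofHom (algebraMap k L₀)) := by
    rw [← Category.assoc, hτν, hext, Category.assoc, M.gen_π, ← Spec.map_comp,
      ← CommRingCat.ofHom_comp, ← IsScalarTower.algebraMap_eq]
  have hgenpt : (fromSpecExtension M.X L₀).toNormalization (IsLocalRing.closedPoint L₀) =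
      genericPoint (normalizationIn M.X L₀) :=
    toNormalization_apply M.X L₀ _
  have hiso : IsIso (Scheme.stalkClosedPointTo (fromSpecExtension M.X L₀).toNormalization) := by
    haveI : IsPreimmersion (fromSpecExtension M.X L₀).toNormalization :=
      isPreimmersion_toNormalization M.X L₀
    have hs : Function.Surjective
        (Scheme.stalkClosedPointTo (fromSpecExtension M.X L₀).toNormalization).hom := by
      intro l
      obtain ⟨s, hs⟩ := (stalkClosedPointIso (.of L₀)).commRingCatIsoToRingEquiv.surjective l
      obtain ⟨t, rfl⟩ := (fromSpecExtension M.X L₀).toNormalization.stalkMap_surjective _ s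
      exact ⟨t, hs⟩
    have hF : IsField ((normalizationIn M.X L₀).presheaf.stalk
        ((fromSpecExtension M.X L₀).toNormalization (IsLocalRing.closedPoint L₀))) := by
      rw [hgenpt]
      exact Field.toIsField (normalizationIn M.X L₀).functionField
    exact isIso_of_isField_of_surjective _ hF hs
  refine ⟨{ X := normalizationIn M.X L₀
            π := normalizationInι M.X L₀ ≫ M.π
            gen := (fromSpecExtension M.X L₀).toNormalization
            gen_π := hgenπ
            isIntegral := inferInstance
            isProper := inferInstance
            genericPt_eq := hgenpt
            isIso_stalkClosedPointTo := hiso }, normalizationInι M.X L₀, rfl, ?_⟩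
  change (fromSpecExtension M.X L₀).toNormalization ≫ normalizationInι M.X L₀ = _
  rw [hτν, hext]

/-! ## `Pialt` implies purely inseparable two-model patching -/

/-- **EXACTNESS of the PiTMP residual: the crux `Pialt` implies purely inseparable two-model patching in
every prime characteristic `p`.** Given proper models `M₁` of `L₁/k` and `M₂` of `L₂/k` (`Lᵢ/K` finite
purely inseparable), choose one finite purely inseparable `L₀ ⊇ L₁, L₂` over `K`
(`exists_common_purelyInseparable_extension₂`), the proper models `M₁^{L₀}`, `M₂^{L₀}` of `L₀/k`
(`ProperModel.exists_normalizationIn_model`) and their join `J` (`ProperModel.join`). `Pialt` at the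
integral proper `k`-scheme `J` yields `g : Y → J` proper surjective with `Y` integral and regular, finite
and universally injective over a dense open, hence over an affine open neighbourhood of the generic
point: so `L := K(Y)` is finite and purely inseparable over `K(J) ≅ L₀`
(`finiteDimensional_functionFieldOver_of_finite`,
`isPurelyInseparable_functionFieldOver_of_universallyInjective`), hence over `K`; `N := (Y, Spec K(Y) → Y)`
is a proper model of `L/k`, the composites `Y → J → Mᵢ^{L₀} → Mᵢ` dominate `Mᵢ` compatibly with the
generic points, and `N` is regular everywhere. [cite: Temkin2013, Conj. 1.3.1] -/
theorem piTwoModelPatching_of_pialt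
    (hP : Summit.ResolutionOfSingularities.ResolutionOfSingularities.Theses.PAlteration.Pialt)
    (p : ℕ) (hp : p.Prime) :
    ∀ (k : Type) [Field k] [CharP k p] (K : Type) [Field K] [Algebra k K]
      (L₁ : Type) [Field L₁] [Algebra K L₁] [Algebra k L₁] [IsScalarTower k K L₁]
      [FiniteDimensional K L₁] [IsPurelyInseparable K L₁]
      (L₂ : Type) [Field L₂] [Algebra K L₂] [Algebra k L₂] [IsScalarTower k K L₂]
      [FiniteDimensional K L₂] [IsPurelyInseparable K L₂]
      (M₁ : ProperModel k L₁) (M₂ : ProperModel k L₂),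
      ∃ (L : Type) (_ : Field L) (_ : Algebra K L) (_ : Algebra k L) (_ : IsScalarTower k K L)
        (ι₁ : L₁ →ₐ[K] L) (ι₂ : L₂ →ₐ[K] L),
        FiniteDimensional K L ∧ IsPurelyInseparable K L ∧
        ∃ (N : ProperModel k L) (φ₁ : N.X ⟶ M₁.X) (φ₂ : N.X ⟶ M₂.X),
          φ₁ ≫ M₁.π = N.π ∧ φ₂ ≫ M₂.π = N.π ∧
          N.gen ≫ φ₁ = Spec.map (CommRingCat.ofHom ι₁.toRingHom) ≫ M₁.gen ∧
          N.gen ≫ φ₂ = Spec.map (CommRingCat.ofHom ι₂.toRingHom) ≫ M₂.gen ∧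
          ∀ n : N.X, (IsRegularLocalRing (M₁.X.presheaf.stalk (φ₁.base n)) ∨
              IsRegularLocalRing (M₂.X.presheaf.stalk (φ₂.base n))) →
            IsRegularLocalRing (N.X.presheaf.stalk n) := by
  intro k _ _ K _ _ L₁ _ _ _ _ _ _ L₂ _ _ _ _ _ _ M₁ M₂
  -- Step A: one finite purely inseparable `L₀ ⊇ L₁, L₂` over `K`, a `k`-algebra through `K`
  obtain ⟨L₀, _, _, hfd₀, hpi₀, ⟨e₁⟩, ⟨e₂⟩⟩ := exists_common_purelyInseparable_extension₂ K L₁ L₂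
  haveI := hfd₀
  haveI := hpi₀
  letI algkL₀ : Algebra k L₀ := ((algebraMap K L₀).comp (algebraMap k K)).toAlgebra
  haveI : IsScalarTower k K L₀ := IsScalarTower.of_algebraMap_eq fun _ => rfl
  letI : Algebra L₁ L₀ := e₁.toRingHom.toAlgebra
  letI : Algebra L₂ L₀ := e₂.toRingHom.toAlgebra
  haveI : IsScalarTower K L₁ L₀ := IsScalarTower.of_algebraMap_eq fun x => (e₁.commutes x).symm
  haveI : IsScalarTower K L₂ L₀ := IsScalarTower.of_algebraMap_eq fun x => (e₂.commutes x).symm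
  haveI : IsScalarTower k L₁ L₀ := IsScalarTower.of_algebraMap_eq fun x => by
    change algebraMap K L₀ (algebraMap k K x) = e₁ (algebraMap k L₁ x)
    rw [IsScalarTower.algebraMap_apply k K L₁, e₁.commutes]
  haveI : IsScalarTower k L₂ L₀ := IsScalarTower.of_algebraMap_eq fun x => by
    change algebraMap K L₀ (algebraMap k K x) = e₂ (algebraMap k L₂ x)
    rw [IsScalarTower.algebraMap_apply k K L₂, e₂.commutes]
  haveI : FiniteDimensional L₁ L₀ := Module.Finite.of_restrictScalars_finite K L₁ L₀
  haveI : FiniteDimensional L₂ L₀ := Module.Finite.of_restrictScalars_finite K L₂ L₀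
  -- Step B: proper models of `L₀` dominating `M₁`, `M₂` (normalisations), and their join
  obtain ⟨P₁, ν₁, hν₁π, hν₁gen⟩ := M₁.exists_normalizationIn_model L₀
  obtain ⟨P₂, ν₂, hν₂π, hν₂gen⟩ := M₂.exists_normalizationIn_model L₀
  let J : ProperModel k L₀ := ProperModel.join P₁ P₂
  -- Step C: `Pialt` at `J`
  obtain ⟨Y, g, hgprop, hYint, hreg, hsurj, U, hUd, hfinU, huiU⟩ :=
    hP p hp k J.X J.π inferInstance inferInstance inferInstance inferInstance
  haveI := hgprop
  haveI := hYint
  haveI : IsDominant g := ⟨hsurj.denseRange⟩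
  -- an affine open `V ⊆ U` of `J` containing the generic point
  have hξU : genericPoint J.X ∈ U :=
    ((genericPoint_spec J.X).mem_open_set_iff U.isOpen).mpr (by simpa using hUd.nonempty)
  obtain ⟨_, ⟨V, hVaff, rfl⟩, hξV, hVU⟩ :=
    J.X.isBasis_affineOpens.exists_subset_of_mem_open hξU U.isOpen
  haveI : IsFinite (g ∣_ V) := morphismRestrict_of_le g (P := @IsFinite) hVU hfinU
  haveI : UniversallyInjective (g ∣_ V) :=
    morphismRestrict_of_le g (P := @UniversallyInjective) hVU huiU
  have hVaff' : IsAffineOpen (g ⁻¹ᵁ V) :=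
    isAffineOpen_preimage_of_isAffineHom_morphismRestrict g hVaff
  have hfin : (g.app V).hom.Finite :=
    (IsFinite.SpecMap_iff _).mp
      ((morphismRestrict_iff_specMap_app g hVaff hVaff' (P := @IsFinite)).mp ‹_›)
  haveI : UniversallyInjective (Spec.map (g.app V)) :=
    (morphismRestrict_iff_specMap_app g hVaff hVaff' (P := @UniversallyInjective)).mp ‹_›
  -- Step D: `L := K(Y)` is finite purely inseparable over `K(J) ≅ L₀`, hence over `K`
  haveI : FiniteDimensional J.X.functionField (Literature.AlgebraicGeometry.Motives.FunctionFieldOver g) :=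
    finiteDimensional_functionFieldOver_of_finite g hξV hVaff' hfin
  haveI : IsPurelyInseparable J.X.functionField
      (Literature.AlgebraicGeometry.Motives.FunctionFieldOver g) :=
    isPurelyInseparable_functionFieldOver_of_universallyInjective g hξV hVaff'
  let L := Literature.AlgebraicGeometry.Motives.FunctionFieldOver g
  let F : Type := J.X.functionField
  letI algL₀F : Algebra L₀ F := J.funFieldIso.inv.hom.toAlgebra
  letI algL₀L : Algebra L₀ L := ((algebraMap F L).comp (algebraMap L₀ F)).toAlgebra
  haveI : IsScalarTower L₀ F L := IsScalarTower.of_algebraMap_eq fun _ => rfl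
  letI algKL : Algebra K L := ((algebraMap L₀ L).comp (algebraMap K L₀)).toAlgebra
  haveI : IsScalarTower K L₀ L := IsScalarTower.of_algebraMap_eq fun _ => rfl
  letI algkL : Algebra k L := ((algebraMap K L).comp (algebraMap k K)).toAlgebra
  haveI towerkKL : IsScalarTower k K L := IsScalarTower.of_algebraMap_eq fun _ => rfl
  have hbijF : Function.Bijective (algebraMap L₀ F) :=
    J.funFieldIso.symm.commRingCatIsoToRingEquiv.bijective
  haveI : Module.Finite L₀ F := Module.Finite.of_surjective (Algebra.linearMap L₀ F) hbijF.2
  haveI : IsPurelyInseparable L₀ F :=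
    AlgEquiv.isPurelyInseparable (AlgEquiv.ofBijective (Algebra.ofId L₀ F) hbijF)
  haveI : Module.Finite L₀ L := Module.Finite.trans F L
  haveI : IsPurelyInseparable L₀ L := IsPurelyInseparable.trans L₀ F L
  have hfdKL : FiniteDimensional K L := Module.Finite.trans L₀ L
  have hpiKL : IsPurelyInseparable K L := IsPurelyInseparable.trans K L₀ L
  -- Step E: `Y` with its generic point `γ : Spec K(Y) → Y` is a proper model `N` of `L/k`
  let γ : Spec (.of L) ⟶ Y := Y.fromSpecStalk (genericPoint Y)
  have hgenJ : γ ≫ g = Spec.map (CommRingCat.ofHom (algebraMap L₀ L)) ≫ J.gen := by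
    change Y.fromSpecStalk (genericPoint Y) ≫ g = Spec.map (CommRingCat.ofHom
      ((Literature.AlgebraicGeometry.Motives.RatFn.functionFieldMap g).comp J.funFieldIso.inv.hom)) ≫
        J.gen
    rw [CommRingCat.ofHom_comp, CommRingCat.ofHom_hom, Spec.map_comp, Category.assoc,
      ← ProperModel.fromSpecStalk_genericPoint_eq, specMap_functionFieldMap_fromSpecStalk]
  have hgenπ : γ ≫ g ≫ J.π = Spec.map (CommRingCat.ofHom (algebraMap k L)) := by
    rw [← Category.assoc, hgenJ, Category.assoc, J.gen_π, ← Spec.map_comp, ← CommRingCat.ofHom_comp]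
    -- `algebraMap k L = (algebraMap L₀ L).comp (algebraMap k L₀)` by construction (closed by `rfl`)
  have hgenpt : γ (IsLocalRing.closedPoint L) = genericPoint Y := Scheme.fromSpecStalk_closedPoint
  have hiso : IsIso (Scheme.stalkClosedPointTo γ) := by
    have h := Scheme.stalkClosedPointTo_fromSpecStalk (X := Y) (genericPoint Y)
    change IsIso (Scheme.stalkClosedPointTo (Y.fromSpecStalk (genericPoint Y)))
    rw [h]
    infer_instance
  let N : ProperModel k L :=
    { X := Y
      π := g ≫ J.π
      gen := γ
      gen_π := hgenπ
      isIntegral := hYint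
      isProper := inferInstance
      genericPt_eq := hgenpt
      isIso_stalkClosedPointTo := hiso }
  -- the two embeddings `Lᵢ → L₀ → L` over `K`
  let ι₁ : L₁ →ₐ[K] L := (IsScalarTower.toAlgHom K L₀ L).comp e₁
  let ι₂ : L₂ →ₐ[K] L := (IsScalarTower.toAlgHom K L₀ L).comp e₂
  have hι₁ : CommRingCat.ofHom ι₁.toRingHom =
      CommRingCat.ofHom (algebraMap L₁ L₀) ≫ CommRingCat.ofHom (algebraMap L₀ L) := by
    ext x; rfl
  have hι₂ : CommRingCat.ofHom ι₂.toRingHom =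
      CommRingCat.ofHom (algebraMap L₂ L₀) ≫ CommRingCat.ofHom (algebraMap L₀ L) := by
    ext x; rfl
  refine ⟨L, inferInstance, algKL, algkL, towerkKL, ι₁, ι₂, hfdKL, hpiKL, N,
    g ≫ (ProperModel.joinFst P₁ P₂).f ≫ ν₁, g ≫ (ProperModel.joinSnd P₁ P₂).f ≫ ν₂,
    ?_, ?_, ?_, ?_, fun n _ => hreg n⟩
  · change (g ≫ (ProperModel.joinFst P₁ P₂).f ≫ ν₁) ≫ M₁.π = g ≫ J.π
    simp only [Category.assoc]
    rw [hν₁π, (ProperModel.joinFst P₁ P₂).f_π]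
  · change (g ≫ (ProperModel.joinSnd P₁ P₂).f ≫ ν₂) ≫ M₂.π = g ≫ J.π
    simp only [Category.assoc]
    rw [hν₂π, (ProperModel.joinSnd P₁ P₂).f_π]
  · change γ ≫ g ≫ (ProperModel.joinFst P₁ P₂).f ≫ ν₁ = _
    rw [← Category.assoc, hgenJ, Category.assoc, ← Category.assoc J.gen,
      (ProperModel.joinFst P₁ P₂).gen_f, hν₁gen, hι₁, Spec.map_comp, Category.assoc]
  · change γ ≫ g ≫ (ProperModel.joinSnd P₁ P₂).f ≫ ν₂ = _
    rw [← Category.assoc, hgenJ, Category.assoc, ← Category.assoc J.gen,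
      (ProperModel.joinSnd P₁ P₂).gen_f, hν₂gen, hι₂, Spec.map_comp, Category.assoc]

end Summit.ResolutionOfSingularities.ResolutionOfSingularities.Theorems.Pialt.RadiciallyRegular

end
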